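import Summits.BirchSwinnertonDyer.Rank1Residual.X10.ResidualSelmerParityRat
import Summits.BirchSwinnertonDyer.Rank1Residual.X10.SelmerCompanions
import Summits.BirchSwinnertonDyer.Rank1Residual.GaloisImage.SelmerLocalKerUnramifiedOfKummerCondition
import Literature.NumberTheory.EllipticCurves.CongruenceVisibility
import Literature.NumberTheory.EllipticCurves.MazurRubin2015.KummerImageGoodReduction
import HarnessLib

/-!
# `S⁰` COMPANIONS: the residual Selmer group `S⁰(E) ⊆ H¹(K, E[p])` depends only on `E[p]` (given the
# Kummer conditions above `p` agree) — transport along a `Γ`-isomorphism `θ : A[p] ⥲ E[p]`, and the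
# N2 reading of the parity records as a theorem: NO UNIT COMPANION for a cell with `S⁰(E) ≠ 0`
# (cell `b2b-bsdres`, unit `b2b-bsdres-x10` = N2 class lead, GEN 32; theorems only, no definition,
# named-fact hypotheses `hMR` (Mazur–Rubin 2015 Thm. 3.1 (iv)(b)) and, in §4, the Poitou–Tate fact;
# nothing booked)

HONEST FRAMING (run/shared/lean/b2b/bsd-rank1-residual/, verbatim in every file): the goal of the
cell is to DELETE the COMBINATION-SHAPED residual classes of the Birch–Swinnerton-Dyer formula for
ALL analytic-rank `≤ 1` elliptic curves over `ℚ` — "full BSD formula for every rank `≤ 1` curve in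
class `C`" assembled STRICTLY from published theorems — so that the rank-`≤ 1` remainder becomes
exactly the CONSTRUCTION-SHAPED classes, which are TYPED (missing-input `Prop`s), NOT attempted.
This is not "finishing BSD". Class X10b (= N2) keeps its label CONSTRUCTION-SHAPED (NEEDS `X_A3`,
referee R82.3 / RESIDUAL-MAP §I N2); this file is a TOOL; no mark / label / tier / count moves.

## What

Mazur–Rubin 2007 (remark after Def. 1.2): the residual Selmer group `S⁰(E) = H¹_𝓖(K, E[p])`
(`X10/ResidualSelmerGroup.residualSelmerGroup`: unramified classes at the finite `v ∤ p`, Kummer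
condition above `p` and at `∞`) is a function of the Galois module `E[p]` together with the Kummer
conditions above `p`. Here, for elliptic curves `E = W`, `A = W'` over `ℚ`, `p` odd, and a
`Γ_ℚ`-equivariant `θ : A[p] ⥲ E[p]` with transport `θ_* = h1Equiv θ` on `H¹(ℚ, ·[p])`:

* §1 `localization_mem_unramifiedSubgroup_iff_mem_unramifiedKer` — the BRIDGE between the two
  "unramified" currencies of the tree at a finite place `v` (any number field, any level `n`):
  `loc_v c ∈ H¹_ur(K_v, E[n])` (`DiscreteGaloisModule.unramifiedSubgroup` of the local module) iff
  `c ∈ unramifiedKer (E[n]) 𝔓_v` (Silverman's kernel of `H¹(K, E[n]) → H¹(I_{𝔓_v}, E[n])` at the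
  prime `𝔓_v = adicCompletionPrime K v` of `\bar ℤ`); the proof is n1011-p10's
  (`selmerLocalKer_eq_unramifiedKer_of_kummerLocalConditionAt_eq`) with the Kummer step removed.
* §2 `mem_residualSelmerGroup_iff_h1Equiv_mem` — **`c ∈ S⁰(A) ↔ θ_* c ∈ S⁰(E)`** when both curves
  have good reduction above `p`: at `∞` both conditions hold for odd `p` (x11a
  `mem_selmerLocalKer_infinitePlace_of_odd`), above `p` the Kummer conditions agree by Mazur–Rubin
  2015 Thm. 3.1 (iv)(b) (`e(ℚ_p/ℚ_p) = 1 < p − 1`; the named fact `hMR`,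
  `selmerLocalKer_iff_of_goodReduction_above_rat`), at the finite `v ∤ p` unramifiedness transports
  (`mem_unramifiedKer_iff_h1Equiv_mem` + §1). Hence §3 **`natCard_residualSelmerGroup_eq_of_congr`**:
  `#S⁰(A) = #S⁰(E)`, and `residualSelmerGroup_eq_bot_iff_of_congr`.
* §4 THE N2 READING AS A THEOREM. With (X) for Tamagawa-`p`-free `A`
  (`residualSelmerGroup_eq_selmerGroup_of_not_dvd_tamagawaProduct`, fact-free):
  `natCard_selmerGroup_eq_natCard_residualSelmerGroup_of_congr` (`#Sel_p(A) = #S⁰(E)`) and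
  **`natCard_selmerGroup_ne_one_of_congr_of_residualSelmerGroup_ne_bot`**: `S⁰(E) ≠ ⊥` ⟹ every
  Tamagawa-`p`-free good-at-`p` curve `A` `p`-congruent to `E` has `Sel_p(A) ≠ 0` — NO UNIT COMPANION;
  row-check form `natCard_selmerGroup_ne_one_of_congr_of_rowCheck` (the parity NO-GO of
  `ResidualSelmerParityRat` + this transport): feed it any record of
  `X10/ResidualSelmerParityRecords*` (73 parity-odd N2 cells). CONDITIONAL on `hMR` and (§4, row
  form) the Poitou–Tate fact; `θ` per pair is EVIDENCE (KO-certified rows / Hesse certificates).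

References: [MazurRubin2007] Def. 1.2, Prop. 1.3, Thm. 1.4; [MazurRubin2015SelmerCompanions]
Thm. 3.1 (iv)(b); [MilneADT2006] I §2, Prop. 3.8; [SilvermanAEC2009] VIII.§2, X.§4;
HOME/class-closure/N2/TRIVIAL-ROADS-x10g27.md (X), (P), (C2); HOME/X10-AUDIT.md §38.
-/

set_option autoImplicit false

noncomputable section

open scoped Classical

open Function WeierstrassCurve Field Literature.NumberTheory.EllipticCurves
  Literature.NumberTheory.GaloisRepresentations Literature.NumberTheory.GaloisCohomology NumberField
  IsDedekindDomain Rat.HeightOneSpectrum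
open Literature.NumberTheory.GaloisRepresentations.IsNonarchimedeanLocalField
open Literature.NumberTheory.GaloisRepresentations.DiscreteGaloisModule (unramifiedSubgroup)
open Literature.NumberTheory.EllipticCurves.MazurRubin2015
open Summit.BirchSwinnertonDyer.BirchSwinnertonDyer.Rank2Observatory.Tam
open Summit.BirchSwinnertonDyer.Rank1Residual.Additive
open Summit.BirchSwinnertonDyer.Rank1Residual.X11b.LocBridge
open Summit.BirchSwinnertonDyer.Rank1Residual.X11a.SelmerCompanion
open Summit.BirchSwinnertonDyer.Rank1Residual.X10.ResidualSelmerGroup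
open Summit.BirchSwinnertonDyer.Rank1Residual.X10.ResidualSelmerParityRat

namespace Summit.BirchSwinnertonDyer.Rank1Residual.X10.ResidualSelmerCompanions

/-! ### §1. The bridge `loc_v c ∈ H¹_ur(K_v, E[n]) ↔ c ∈ unramifiedKer (E[n]) 𝔓_v` -/

section Bridge

variable {K : Type} [Field K] [NumberField K] (W : WeierstrassCurve K) (n : ℤ)

/-- **The two unramified currencies agree.** For a class `c ∈ H¹(K, E[n])` and a finite place `v`:
`loc_v c` lies in the unramified subgroup `H¹_ur(K_v, E[n]) = ker (H¹(K_v, ·) → H¹(I_v, ·))` of the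
local module iff `c` is principal on the inertia group `I_{𝔓_v} ≤ Γ_K` of the prime
`𝔓_v = adicCompletionPrime K v` of `\bar ℤ_K` (`unramifiedKer`), because
`I_{𝔓_v} = res (absInertia K_v)` (`inertia_adicCompletionPrime_eq_map_absInertia`). n1011-p10's
argument (`selmerLocalKer_eq_unramifiedKer_of_kummerLocalConditionAt_eq`) without its Kummer step.
[cite: MilneADT2006, Ch. I §2 (unramified cohomology)] [cite: SilvermanAEC2009, VIII.§2 Definition p. 191] -/
theorem localization_mem_unramifiedSubgroup_iff_mem_unramifiedKer (v : HeightOneSpectrum (𝓞 K))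
    (c : galH1Torsion W n) :
    galoisCohomology.localization (W.torsionGaloisModule n) (Sum.inr v) 1 c ∈
        unramifiedSubgroup (GaloisRep.toLocal v (W.torsionGaloisModule n)) 1 ↔
      c ∈ unramifiedKer (geomTorsion W n) (adicCompletionPrime K v) := by
  obtain ⟨φ, rfl⟩ :=
    oneCocycleClass_surjective (discreteTopRep (absoluteGaloisGroup K) (geomTorsion W n)) c
  change galoisCohomology.res (W.torsionGaloisModule n) (v.adicCompletion K) 1
      (oneCocycleClass (discreteTopRep (absoluteGaloisGroup K) (geomTorsion W n)) φ) ∈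
      unramifiedSubgroup (GaloisRep.restrictField (v.adicCompletion K) (W.torsionGaloisModule n)) 1 ↔ _
  rw [res_torsionGaloisModule_oneCocycleClass]
  refine (mem_unramifiedSubgroup_one_iff_exists _ _).trans ?_
  rw [unramifiedKer, oneCocycleClass_mem_subgroupResKer_iff]
  constructor
  · rintro ⟨w, hw⟩
    refine ⟨w, fun σ ↦ ?_⟩
    have hσ : (σ : absoluteGaloisGroup K) ∈
        (absInertia (v.adicCompletion K)).map (absGaloisRestrict K (v.adicCompletion K)).toMonoidHom := by
      rw [← inertia_adicCompletionPrime_eq_map_absInertia]; exact σ.2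
    obtain ⟨τ, hτ, hτσ⟩ := Subgroup.mem_map.mp hσ
    have h := hw τ hτ
    rw [contOneCocycles.pullback_apply] at h
    change φ.1 (absGaloisRestrict K (v.adicCompletion K) τ) =
      absGaloisRestrict K (v.adicCompletion K) τ • w - w at h
    have hτσ' : absGaloisRestrict K (v.adicCompletion K) τ = (σ : absoluteGaloisGroup K) := hτσ
    rw [hτσ'] at h
    exact h
  · rintro ⟨a, ha⟩
    refine ⟨a, fun τ hτ ↦ ?_⟩
    have hmem : absGaloisRestrict K (v.adicCompletion K) τ ∈
        (adicCompletionPrime K v).inertia (absoluteGaloisGroup K) := by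
      rw [inertia_adicCompletionPrime_eq_map_absInertia]
      exact Subgroup.mem_map.mpr ⟨τ, hτ, rfl⟩
    have h := ha ⟨_, hmem⟩
    rw [contOneCocycles.pullback_apply]
    change φ.1 (absGaloisRestrict K (v.adicCompletion K) τ) =
      absGaloisRestrict K (v.adicCompletion K) τ • a - a
    exact h

/-- The Kummer condition of the structure at a place, pulled back: `loc_v c ∈ 𝓛_v ↔ c ∈ 𝓢_v`
(`comap_localization_kummerSelmerStructure`, pointwise). [cite: SilvermanAEC2009, X.§4 (definition of the m-Selmer group)] -/
theorem localization_mem_kummerSelmerStructure_iff (v : Place K) (c : galH1Torsion W n) :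
    galoisCohomology.localization (W.torsionGaloisModule n) v 1 c ∈ W.kummerSelmerStructure n v ↔
      c ∈ selmerLocalKer W (Place.Completion v) n :=
  -- `c ∈ comap loc_v 𝓛_v` is `loc_v c ∈ 𝓛_v` by definition (no `rw` across the two instance paths of
  -- `H¹(K, E[n])`, cf. `selmerGroup_eq_selmerGroup_kummerSelmerStructure`)
  SetLike.ext_iff.mp (W.comap_localization_kummerSelmerStructure n v) c

end Bridge

/-! ### §2. Transport of `S⁰` membership along `θ : A[p] ⥲ E[p]` (over `ℚ`, both good above `p`) -/

section Transport

variable (W W' : WeierstrassCurve ℚ) [W.IsElliptic] [W'.IsElliptic] (p : ℕ) [hp : Fact p.Prime]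

/-- **`c ∈ S⁰(A) ↔ θ_* c ∈ S⁰(E)`** for `p` odd, `θ : A[p] ⥲ E[p]` `Γ_ℚ`-equivariant, `A = W'`,
`E = W` both of good reduction above `p`: at `∞` every class satisfies the Kummer condition (`p`
odd), above `p` the Kummer conditions agree along `θ` (Mazur–Rubin 2015 Thm. 3.1 (iv)(b), the named
fact `hMR`), at the finite `v ∤ p` the unramified conditions agree along `θ` (§1 +
`mem_unramifiedKer_iff_h1Equiv_mem`). CONDITIONAL on `hMR`.
[cite: MazurRubin2007, Def. 1.2] [cite: MazurRubin2015SelmerCompanions, Thm. 3.1 (iv)(b)] -/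
theorem mem_residualSelmerGroup_iff_h1Equiv_mem (hMR : selmerLocalKer_iff_of_goodReduction_above)
    (hp2 : p ≠ 2) (θ : geomTorsion W' (p : ℤ) ≃+ geomTorsion W (p : ℤ))
    (hθ : ∀ (σ : absoluteGaloisGroup ℚ) (P : geomTorsion W' (p : ℤ)), θ (σ • P) = σ • θ P)
    (hgood : ∀ v : HeightOneSpectrum (𝓞 ℚ), (p : 𝓞 ℚ) ∈ v.asIdeal →
      W.HasGoodReductionAt v ∧ W'.HasGoodReductionAt v)
    (c : galH1Torsion W' (p : ℤ)) :
    c ∈ residualSelmerGroup W' p ↔ h1Equiv θ hθ c ∈ residualSelmerGroup W p := by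
  rw [mem_residualSelmerGroup_iff, mem_residualSelmerGroup_iff]
  refine and_congr ?_ (and_congr ?_ ?_)
  · -- archimedean places: both hold (`p` odd); `Place.Completion (inl w) = w.Completion` definitionally
    refine iff_of_true (fun w => ?_) (fun w => ?_)
    · exact (localization_mem_kummerSelmerStructure_iff W' (p : ℤ) (Sum.inl w) c).mpr
        (mem_selmerLocalKer_infinitePlace_of_odd W' hp2 hp.out w c)
    · exact (localization_mem_kummerSelmerStructure_iff W (p : ℤ) (Sum.inl w) _).mpr
        (mem_selmerLocalKer_infinitePlace_of_odd W hp2 hp.out w _)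
  · -- above `p`: Mazur–Rubin 2015 Thm. 3.1 (iv)(b); `Place.Completion (inr v) = v.adicCompletion ℚ`
    refine forall_congr' fun v => forall_congr' fun hv => ?_
    exact (localization_mem_kummerSelmerStructure_iff W' (p : ℤ) (Sum.inr v) c).trans
      ((selmerLocalKer_iff_of_goodReduction_above_rat hMR W W' hp2 θ hθ v hv (hgood v hv).1
        (hgood v hv).2 c).trans
        (localization_mem_kummerSelmerStructure_iff W (p : ℤ) (Sum.inr v) _).symm)
  · -- finite `v ∤ p`: unramified ↔ unramified
    refine forall_congr' fun v => forall_congr' fun hv => ?_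
    rw [residualSelmerStructure_inr_of_not_mem W' p hv, residualSelmerStructure_inr_of_not_mem W p hv]
    exact (localization_mem_unramifiedSubgroup_iff_mem_unramifiedKer W' (p : ℤ) v c).trans
      ((mem_unramifiedKer_iff_h1Equiv_mem W W' θ hθ _ c).trans
        (localization_mem_unramifiedSubgroup_iff_mem_unramifiedKer W (p : ℤ) v _).symm)

/-! ### §3. `#S⁰(A) = #S⁰(E)` -/

/-- **`S⁰` companions: `#S⁰(A) = #S⁰(E)`** for `p` odd, `θ : A[p] ⥲ E[p]` `Γ_ℚ`-equivariant, both
curves good above `p` (`θ_*` restricts to a bijection `S⁰(A) ⥲ S⁰(E)`, §2). CONDITIONAL on `hMR`.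
[cite: MazurRubin2007, Def. 1.2] [cite: MazurRubin2015SelmerCompanions, Thm. 3.1 (iv)(b)] -/
theorem natCard_residualSelmerGroup_eq_of_congr (hMR : selmerLocalKer_iff_of_goodReduction_above)
    (hp2 : p ≠ 2) (θ : geomTorsion W' (p : ℤ) ≃+ geomTorsion W (p : ℤ))
    (hθ : ∀ (σ : absoluteGaloisGroup ℚ) (P : geomTorsion W' (p : ℤ)), θ (σ • P) = σ • θ P)
    (hgood : ∀ v : HeightOneSpectrum (𝓞 ℚ), (p : 𝓞 ℚ) ∈ v.asIdeal →
      W.HasGoodReductionAt v ∧ W'.HasGoodReductionAt v) :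
    Nat.card (residualSelmerGroup W' p) = Nat.card (residualSelmerGroup W p) :=
  Nat.card_congr ((h1Equiv θ hθ).toEquiv.subtypeEquiv
    (mem_residualSelmerGroup_iff_h1Equiv_mem W W' p hMR hp2 θ hθ hgood))

/-- `S⁰(A) = ⊥ ↔ S⁰(E) = ⊥` along `θ`. CONDITIONAL on `hMR`.
[cite: MazurRubin2007, Def. 1.2] [cite: MazurRubin2015SelmerCompanions, Thm. 3.1 (iv)(b)] -/
theorem residualSelmerGroup_eq_bot_iff_of_congr (hMR : selmerLocalKer_iff_of_goodReduction_above)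
    (hp2 : p ≠ 2) (θ : geomTorsion W' (p : ℤ) ≃+ geomTorsion W (p : ℤ))
    (hθ : ∀ (σ : absoluteGaloisGroup ℚ) (P : geomTorsion W' (p : ℤ)), θ (σ • P) = σ • θ P)
    (hgood : ∀ v : HeightOneSpectrum (𝓞 ℚ), (p : 𝓞 ℚ) ∈ v.asIdeal →
      W.HasGoodReductionAt v ∧ W'.HasGoodReductionAt v) :
    residualSelmerGroup W' p = ⊥ ↔ residualSelmerGroup W p = ⊥ := by
  constructor
  · intro h
    rw [eq_bot_iff]
    intro d hd
    have hc : (h1Equiv θ hθ).symm d ∈ residualSelmerGroup W' p := by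
      rw [mem_residualSelmerGroup_iff_h1Equiv_mem W W' p hMR hp2 θ hθ hgood, AddEquiv.apply_symm_apply]
      exact hd
    rw [h, AddSubgroup.mem_bot, AddEquiv.symm_apply_eq] at hc
    rw [AddSubgroup.mem_bot, hc, map_zero]
  · intro h
    rw [eq_bot_iff]
    intro c hc
    have hd := (mem_residualSelmerGroup_iff_h1Equiv_mem W W' p hMR hp2 θ hθ hgood c).mp hc
    rw [h, AddSubgroup.mem_bot, map_eq_zero_iff _ (h1Equiv θ hθ).injective] at hd
    exact (AddSubgroup.mem_bot).mpr hd

/-! ### §4. The N2 reading as a theorem: NO UNIT COMPANION for a cell with `S⁰(E) ≠ 0` -/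

/-- **(X) + transport: `#Sel_p(A) = #S⁰(E)`** for a Tamagawa-`p`-free `A` (`p ∤ ∏ c_ℓ(A)`)
`p`-congruent to `E` along `θ`, both good above `p`: `Sel_p(A) = S⁰(A)`
(`residualSelmerGroup_eq_selmerGroup_of_not_dvd_tamagawaProduct`, fact-free) and `#S⁰(A) = #S⁰(E)`
(§3). THE N2 READING: the `3`-Selmer group of every Tamagawa-`3`-free good-at-`3` partner of a cell
has the order of the cell's residual group. CONDITIONAL on `hMR`.
[cite: MazurRubin2007, Def. 1.2 and Thm. 1.4] [cite: MazurRubin2015SelmerCompanions, Thm. 3.1 (iv)(b)] -/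
theorem natCard_selmerGroup_eq_natCard_residualSelmerGroup_of_congr
    (hMR : selmerLocalKer_iff_of_goodReduction_above) (hp2 : p ≠ 2)
    (θ : geomTorsion W' (p : ℤ) ≃+ geomTorsion W (p : ℤ))
    (hθ : ∀ (σ : absoluteGaloisGroup ℚ) (P : geomTorsion W' (p : ℤ)), θ (σ • P) = σ • θ P)
    (hgood : ∀ v : HeightOneSpectrum (𝓞 ℚ), (p : 𝓞 ℚ) ∈ v.asIdeal →
      W.HasGoodReductionAt v ∧ W'.HasGoodReductionAt v)
    (htamA : ¬ p ∣ W'.tamagawaProduct) :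
    Nat.card (W'.selmerGroup (p : ℤ)) = Nat.card (residualSelmerGroup W p) := by
  have h := natCard_residualSelmerGroup_eq_of_congr W W' p hMR hp2 θ hθ hgood
  rwa [residualSelmerGroup_eq_selmerGroup_of_not_dvd_tamagawaProduct W' p htamA] at h

/-- **NO UNIT COMPANION.** If `S⁰(E) ≠ ⊥` then no Tamagawa-`p`-free curve `A`, good above `p` and
`p`-congruent to `E` (along a `Γ_ℚ`-isomorphism `θ : A[p] ⥲ E[p]`), has `Sel_p(A) = 0`: a unit
companion would give `S⁰(E) ≅ S⁰(A) = Sel_p(A) = 0`. THE N2 READING (memo TRIVIAL-ROADS (P)/(C2)):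
fed with a parity record `residualSelmerGroup_ne_bot_e<E>` (`X10/ResidualSelmerParityRecords*`, 73
parity-odd cells) it closes the unit road and the Tamagawa-free trivial-partner road to `X_A3` for
that cell EVERYWHERE, not only in Cremona's range. CONDITIONAL on `hMR` (and, through the record, on
the Poitou–Tate fact). [cite: MazurRubin2007, Thm. 1.4] [cite: MazurRubin2015SelmerCompanions, Thm. 3.1 (iv)(b)] -/
theorem natCard_selmerGroup_ne_one_of_congr_of_residualSelmerGroup_ne_bot
    (hMR : selmerLocalKer_iff_of_goodReduction_above) (hp2 : p ≠ 2)
    (θ : geomTorsion W' (p : ℤ) ≃+ geomTorsion W (p : ℤ))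
    (hθ : ∀ (σ : absoluteGaloisGroup ℚ) (P : geomTorsion W' (p : ℤ)), θ (σ • P) = σ • θ P)
    (hgood : ∀ v : HeightOneSpectrum (𝓞 ℚ), (p : 𝓞 ℚ) ∈ v.asIdeal →
      W.HasGoodReductionAt v ∧ W'.HasGoodReductionAt v)
    (htamA : ¬ p ∣ W'.tamagawaProduct) (hE : residualSelmerGroup W p ≠ ⊥) :
    Nat.card (W'.selmerGroup (p : ℤ)) ≠ 1 := fun h1 =>
  hE ((residualSelmerGroup_eq_bot_iff_of_congr W W' p hMR hp2 θ hθ hgood).mp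
    (residualSelmerGroup_eq_bot_of_not_dvd_tamagawaProduct W' p htamA h1))

/-- **A unit companion forces `S⁰(E) = 0`** (the (C2) direction behind the UNIT COMPANION records of
x10 GEN 29/31, now with `S⁰` itself): `Sel_p(A) = 0`, `p ∤ ∏ c_ℓ(A)`, `θ : A[p] ⥲ E[p]`, both good
above `p` ⟹ `S⁰(E) = ⊥`. CONDITIONAL on `hMR`. [cite: MazurRubin2007, Def. 1.2 and Thm. 1.4]
[cite: MazurRubin2015SelmerCompanions, Thm. 3.1 (iv)(b)] -/
theorem residualSelmerGroup_eq_bot_of_unit_congr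
    (hMR : selmerLocalKer_iff_of_goodReduction_above) (hp2 : p ≠ 2)
    (θ : geomTorsion W' (p : ℤ) ≃+ geomTorsion W (p : ℤ))
    (hθ : ∀ (σ : absoluteGaloisGroup ℚ) (P : geomTorsion W' (p : ℤ)), θ (σ • P) = σ • θ P)
    (hgood : ∀ v : HeightOneSpectrum (𝓞 ℚ), (p : 𝓞 ℚ) ∈ v.asIdeal →
      W.HasGoodReductionAt v ∧ W'.HasGoodReductionAt v)
    (htamA : ¬ p ∣ W'.tamagawaProduct) (h1 : Nat.card (W'.selmerGroup (p : ℤ)) = 1) :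
    residualSelmerGroup W p = ⊥ :=
  (residualSelmerGroup_eq_bot_iff_of_congr W W' p hMR hp2 θ hθ hgood).mp
    (residualSelmerGroup_eq_bot_of_not_dvd_tamagawaProduct W' p htamA h1)

end Transport

/-! ### §5. Row-check form: NO UNIT COMPANION for a parity-odd cell, `E`-side in the kernel -/

/-- **NO UNIT COMPANION for a parity-odd cell, census binders IN THE KERNEL.** `p` odd; `W / ℚ`
globally minimal with integral model `E₀`; `Es` a Tate-algorithm row certificate of `E₀` passing the
side check of `ResidualSelmerParityRat.residualSelmerGroup_ne_bot_of_rowCheck` with `k = #T_E`, and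
`p` UNLISTED (good at `p`); `#Sel_p(E) = p^s` (census) with `s + k` odd. Then every elliptic curve
`A / ℚ`, good above `p`, Tamagawa-`p`-free and `p`-congruent to `E` along `θ`, has `#Sel_p(A) ≠ 1`.
CONDITIONAL on the Poitou–Tate fact `hfact` and on `hMR`; `θ`, `A`'s reduction at `p` and
`p ∤ ∏ c_ℓ(A)` are the partner's displayed data. [cite: MazurRubin2007, Prop. 1.3 (i) and Thm. 1.4]
[cite: MazurRubin2015SelmerCompanions, Thm. 3.1 (iv)(b)] [cite: SilvermanATAEC1994, IV.9.4] -/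
theorem natCard_selmerGroup_ne_one_of_congr_of_rowCheck (p : ℕ) [hp : Fact p.Prime] (hp2 : p ≠ 2)
    (hfact : poitouTate_selmerStructure_duality ℚ) (hMR : selmerLocalKer_iff_of_goodReduction_above)
    (W : WeierstrassCurve ℚ) [W.IsElliptic] [W.IsGloballyMinimal] {E₀ : WeierstrassCurve ℤ}
    (hI : integralModelInt W = E₀) {Es : List TamLocal} (hrow : TamLocal.rowCheck Es E₀ = true)
    (hside : (Es.all fun E => decide (E.p = p) || decide (E.kind = 1 ∧ p ∣ E.n) ||
      E.vals.all fun c => !decide (p ∣ c)) = true)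
    (hgoodp : decide (p ∈ Es.map (·.p)) = false)
    {k : ℕ} (hk : (Es.filter fun E => decide (E.kind = 1 ∧ p ∣ E.n ∧ E.p ≠ p)).length = k)
    {s : ℕ} (hs : Nat.card (W.selmerGroup (p : ℤ)) = p ^ s) (hodd : Odd (s + k))
    (A : WeierstrassCurve ℚ) [A.IsElliptic] (θ : geomTorsion A (p : ℤ) ≃+ geomTorsion W (p : ℤ))
    (hθ : ∀ (σ : absoluteGaloisGroup ℚ) (P : geomTorsion A (p : ℤ)), θ (σ • P) = σ • θ P)
    (hgoodA : ∀ v : HeightOneSpectrum (𝓞 ℚ), (p : 𝓞 ℚ) ∈ v.asIdeal → A.HasGoodReductionAt v)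
    (htamA : ¬ p ∣ A.tamagawaProduct) :
    Nat.card (A.selmerGroup (p : ℤ)) ≠ 1 := by
  have hE := residualSelmerGroup_ne_bot_of_rowCheck p hp2 hfact W hI hrow hside hk hs hodd
  have hW := IntModelTam.eq_baseChange_of_integralModelInt hI
  subst hW
  refine natCard_selmerGroup_ne_one_of_congr_of_residualSelmerGroup_ne_bot (E₀.baseChange ℚ) A p hMR
    hp2 θ hθ (fun v hv => ⟨?_, hgoodA v hv⟩) htamA hE
  have hvp : natGenerator v = p := (natCast_mem_asIdeal_iff_natGenerator_eq hp.out v).mp hv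
  exact hasGoodReductionAt_of_not_mem hrow v (by rw [hvp]; exact of_decide_eq_false hgoodp)

end Summit.BirchSwinnertonDyer.Rank1Residual.X10.ResidualSelmerCompanions

end
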